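import Mathlib
import Summits.MatrixMultiplication.MatrixMultiplication.Theorems.SnSubsetDichotomyHyperoctahedralThresholdStubPatternTwin

/-!
# Clean reflection structures are clean closed rung walks (crux `HyperoctahedralThreshold`, stmt-10883)

Setting of the refutation line `refutation-local-symmetry` (skeleton
`Cruxes/HyperoctahedralThreshold/Lines/refutation_local_symmetry.lean`): three involutions `μ c` of `Fin n`
("colours"); a colour word `w : List (Fin 3)` acts on the right, `x · w := w.foldl (fun v c => μ c v) x`.

A **reflection structure** (crux NOTES §2 (S-refl), §15.1 — a loop-to-loop path of the rung graph) is
`(a; c, v, c')`: a point `a`, colours `c, c'` and a reduced word `v` (consecutive letters distinct) not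
starting with `c` and not ending with `c'` (`c ≠ c'` if `v = []`), such that the `c`-rung `{a, a·c}` is
carried by `v` onto a `c'`-rung: `(a · v) · c' = (a · c) · v`.  Then `a` AND `a · c` are fixed points of the
cyclically reduced word `z := v ++ [c'] ++ v.reverse ++ [c]` (the product of the involution words `v c' v⁻¹`
and `c`; pigeonhole on the `≈ 6·2^L` involution words of length `≤ 2L+1` acting on one vertex produces such
structures with `|v| ≤ 2L` as soon as `6·2^L > n`).  Its rungs are `r_t := {a · v.take t, (a · c) · v.take t}`,
`t ≤ |v|`; the structure is **clean** when the rungs are pairwise equal-or-disjoint (three-way form of the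
line: equal, equal with the two sides swapped, or disjoint).

Main results (pure finite combinatorics; no hypothesis on `n`, only `μ c * μ c = 1`):
* `CleanReflection.twoPoint_walk` — two distinct fixed points `x, y` of a cyclically reduced `z` whose
  trajectories have mirror-compatible coincidences (`x·z_s = x·z_t ↔ y·z_s = y·z_t` and
  `x·z_s = y·z_t ↔ y·z_s = x·z_t` for all `s, t < |z|`) and avoid `R` give closed-rung-walk data in the exact
  format of the conclusion of the line's open core `stub_poorRigidCore` (= that of `stub_cleanWalk`), with
  `k + 1 = |z|` rungs — a two-point form of the landed `stub_patternTwin` (p107640) that also allows swapped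
  repetitions of a rung.
* `CleanReflection.reflection_fixed`, `reflection_fixed'`, `reflection_isChain`, `reflection_traj` — the twin
  pair `(z; a, a·c)` of a reflection structure and its trajectories (they run through the structure's rungs,
  forth on one side and back on the other).
* `cleanReflection_walk` — a clean reflection structure all of whose `2(|v|+1)` points avoid `R` yields the
  conclusion-format closed rung walk with `k + 1 = 2|v| + 2`; `cleanReflection_core` adds the length clause
  `k + 1 ≤ n^{1/4}` from `2|v| + 2 ≤ n^{1/4}`.  Hence the open core may be attacked in the form
  "poor ∧ rigid ⇒ some clean `R`-avoiding reflection structure with `2|v| + 2 ≤ n^{1/4}`" (the reflection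
  route of crux NOTES §15; siege variation "pigeonhole on involution words").

Helpers reused: `GoodTwin.foldl_injective`, `GoodTwin.foldl_take_step`, `GoodTwin.cyclic_ne` (p99339),
`PatternTwin.val_add_one` (p107640); `act_reverse` restates `Rotation.foldl_act_reverse` (p111510) to keep the
import closure small.
-/

set_option linter.dupNamespace false

namespace Summit.MatrixMultiplication.MatrixMultiplication.Theorems.HyperoctahedralThreshold

open Equiv

namespace CleanReflection

variable {n : ℕ}

/-- **Two-point clean walk.**  Two distinct fixed points `x ≠ y` of a cyclically reduced colour word `z`
(`|z| ≥ 2`) whose trajectories `t ↦ x · z.take t`, `t ↦ y · z.take t` satisfy, for all `s, t < |z|`,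
`x·z_s = x·z_t ↔ y·z_s = y·z_t` (identical self-coincidence patterns) and `x·z_s = y·z_t ↔ y·z_s = x·z_t`
(crossings occur only as swapped repetitions), and avoid `R`, give closed-rung-walk data
`p t := x · z.take t`, `q t := y · z.take t`, `col t := z[t]` on `Fin (k + 1)`, `k + 1 = |z|`: distinct
rung ends, side-preserving steps, cyclically distinct consecutive colours, pairwise equal-or-disjoint rungs,
all points outside `R`. [folklore] -/
theorem twoPoint_walk (μ : Fin 3 → Perm (Fin n)) (R : Finset (Fin n)) (z : List (Fin 3)) (x y : Fin n)
    (hlen : 2 ≤ z.length) (hchain : List.IsChain (· ≠ ·) (z ++ z)) (hxy : x ≠ y)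
    (hx : z.foldl (fun v c => μ c v) x = x) (hy : z.foldl (fun v c => μ c v) y = y)
    (hpat : ∀ s < z.length, ∀ t < z.length,
      ((z.take s).foldl (fun v c => μ c v) x = (z.take t).foldl (fun v c => μ c v) x ↔
        (z.take s).foldl (fun v c => μ c v) y = (z.take t).foldl (fun v c => μ c v) y) ∧
      ((z.take s).foldl (fun v c => μ c v) x = (z.take t).foldl (fun v c => μ c v) y ↔
        (z.take s).foldl (fun v c => μ c v) y = (z.take t).foldl (fun v c => μ c v) x))
    (hR : ∀ t < z.length,
      (z.take t).foldl (fun v c => μ c v) x ∉ R ∧ (z.take t).foldl (fun v c => μ c v) y ∉ R) :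
    ∃ (k : ℕ) (p q : Fin (k + 1) → Fin n) (col : Fin (k + 1) → Fin 3), (∀ i, p i ≠ q i) ∧
      (∀ i, (μ (col i) (p i) = p (i + 1) ∧ μ (col i) (q i) = q (i + 1)) ∨
        (μ (col i) (p i) = q (i + 1) ∧ μ (col i) (q i) = p (i + 1))) ∧
      (∀ i, col i ≠ col (i + 1)) ∧
      (∀ i j, (p i = p j ∧ q i = q j) ∨ (p i = q j ∧ q i = p j) ∨
        (p i ≠ p j ∧ p i ≠ q j ∧ q i ≠ p j ∧ q i ≠ q j)) ∧
      (∀ i, p i ∉ R ∧ q i ∉ R) ∧ k + 1 = z.length := by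
  obtain ⟨k, hk⟩ : ∃ k, k + 1 = z.length := ⟨z.length - 1, by omega⟩
  have hlt : ∀ i : Fin (k + 1), (i : ℕ) < z.length := fun i => i.isLt.trans_eq hk
  have hval : ∀ i : Fin (k + 1), ((i + 1 : Fin (k + 1)) : ℕ) = ((i : ℕ) + 1) % z.length :=
    fun i => by
      rw [PatternTwin.val_add_one]
      exact congrArg (fun N => ((i : ℕ) + 1) % N) hk
  refine ⟨k, fun i => (z.take i).foldl (fun v c => μ c v) x,
    fun i => (z.take i).foldl (fun v c => μ c v) y, fun i => z[(i : ℕ)]'(hlt i),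
    ?_, ?_, ?_, ?_, ?_, hk⟩
  · -- the two ends of every rung differ (a fixed word acts injectively)
    intro i h
    exact hxy (GoodTwin.foldl_injective μ (z.take i) h)
  · -- the colour `z[t]` maps rung `t` onto rung `t + 1`, side-preservingly
    intro i
    refine Or.inl ⟨?_, ?_⟩
    · show μ (z[(i : ℕ)]'(hlt i)) ((z.take i).foldl (fun v c => μ c v) x) =
        (z.take ((i + 1 : Fin (k + 1)) : ℕ)).foldl (fun v c => μ c v) x
      rw [hval i]
      exact GoodTwin.foldl_take_step μ z x hx i (hlt i)
    · show μ (z[(i : ℕ)]'(hlt i)) ((z.take i).foldl (fun v c => μ c v) y) =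
        (z.take ((i + 1 : Fin (k + 1)) : ℕ)).foldl (fun v c => μ c v) y
      rw [hval i]
      exact GoodTwin.foldl_take_step μ z y hy i (hlt i)
  · -- consecutive colours differ, cyclically
    intro i
    exact GoodTwin.cyclic_ne hchain i _ (hlt i) (hlt (i + 1)) (hval i)
  · -- rungs are pairwise equal, swapped-equal, or disjoint
    intro i j
    obtain ⟨h1, h2⟩ := hpat i (hlt i) j (hlt j)
    by_cases hpp : (z.take i).foldl (fun v c => μ c v) x = (z.take j).foldl (fun v c => μ c v) x
    · exact Or.inl ⟨hpp, h1.1 hpp⟩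
    · by_cases hpq : (z.take i).foldl (fun v c => μ c v) x = (z.take j).foldl (fun v c => μ c v) y
      · exact Or.inr (Or.inl ⟨hpq, h2.1 hpq⟩)
      · exact Or.inr (Or.inr ⟨hpp, hpq, fun h => hpq (h2.2 h), fun h => hpp (h1.2 h)⟩)
  · -- both trajectories avoid `R`
    intro i
    exact hR i (hlt i)

/-- Two rungs that are equal, swapped-equal or disjoint (the second with distinct ends) have mirror-compatible
coincidences. [folklore] -/
theorem eod_iff {α : Type*} {p q p' q' : α} (hpq' : p' ≠ q')
    (h : (p = p' ∧ q = q') ∨ (p = q' ∧ q = p') ∨ (p ≠ p' ∧ p ≠ q' ∧ q ≠ p' ∧ q ≠ q')) :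
    (p = p' ↔ q = q') ∧ (p = q' ↔ q = p') := by
  rcases h with ⟨h1, h2⟩ | ⟨h1, h2⟩ | ⟨h1, h2, h3, h4⟩
  · exact ⟨⟨fun _ => h2, fun _ => h1⟩,
      ⟨fun h => (hpq' (h1.symm.trans h)).elim, fun h => (hpq' (h.symm.trans h2)).elim⟩⟩
  · exact ⟨⟨fun h => (hpq' (h.symm.trans h1)).elim, fun h => (hpq' (h2.symm.trans h)).elim⟩,
      ⟨fun _ => h2, fun _ => h1⟩⟩
  · exact ⟨⟨fun h => (h1 h).elim, fun h => (h4 h).elim⟩, ⟨fun h => (h2 h).elim, fun h => (h3 h).elim⟩⟩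

/-- The action of a concatenation (the line's convention; `List.foldl_append`). [folklore] -/
theorem act_append (μ : Fin 3 → Perm (Fin n)) (x : Fin n) (u w : List (Fin 3)) :
    (u ++ w).foldl (fun v c => μ c v) x = w.foldl (fun v c => μ c v) (u.foldl (fun v c => μ c v) x) := by
  simp [List.foldl_append]

/-- Walking back along the reversed word undoes the walk (letters are involutions); restates
`Rotation.foldl_act_reverse`. [folklore] -/
theorem act_reverse (μ : Fin 3 → Perm (Fin n)) (hμ : ∀ c, μ c * μ c = 1) :
    ∀ (w : List (Fin 3)) (x : Fin n),
      w.reverse.foldl (fun v c => μ c v) (w.foldl (fun v c => μ c v) x) = x := by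
  intro w
  induction w with
  | nil => intro x; rfl
  | cons c w ih =>
    intro x
    rw [List.foldl_cons, List.reverse_cons, act_append, ih]
    show μ c (μ c x) = x
    have : (μ c * μ c) x = x := by rw [hμ c]; rfl
    simpa using this

/-- Walking along `v` and then along the first `j` letters of `v.reverse` lands at the `(|v| - j)`-th
trajectory point (letters are involutions). [folklore] -/
theorem act_reverse_take (μ : Fin 3 → Perm (Fin n)) (hμ : ∀ c, μ c * μ c = 1) (v : List (Fin 3))
    (b : Fin n) (j : ℕ) :
    (v.reverse.take j).foldl (fun v c => μ c v) (v.foldl (fun v c => μ c v) b) =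
      (v.take (v.length - j)).foldl (fun v c => μ c v) b := by
  rw [List.take_reverse]
  have h : v.foldl (fun v c => μ c v) b = (v.drop (v.length - j)).foldl (fun v c => μ c v)
      ((v.take (v.length - j)).foldl (fun v c => μ c v) b) := by
    rw [← act_append, List.take_append_drop]
  rw [h, act_reverse μ hμ]

/-- The doubled word `z := v ++ [c'] ++ v.reverse ++ [c]` of a reflection structure is cyclically reduced.
[folklore] -/
theorem reflection_isChain (c c' : Fin 3) (v : List (Fin 3)) (hv : List.IsChain (· ≠ ·) v)
    (hhead : ∀ e ∈ v.head?, e ≠ c) (hlast : ∀ e ∈ v.getLast?, e ≠ c') (hnil : v = [] → c ≠ c') :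
    List.IsChain (· ≠ ·) ((v ++ [c'] ++ v.reverse ++ [c]) ++ (v ++ [c'] ++ v.reverse ++ [c])) := by
  have hrev : List.IsChain (· ≠ ·) v.reverse :=
    List.isChain_reverse.2 (hv.imp fun a b h => fun h' => h h'.symm)
  -- the first letter of `v ++ [c'] ++ l` is the first letter of `v`, or `c'` if `v = []`; it is not `c`
  have hfirst : ∀ (l : List (Fin 3)), ∀ y ∈ (v ++ [c'] ++ l).head?, c ≠ y := by
    intro l y hy
    rw [List.append_assoc, List.head?_append] at hy
    rcases hvh : v.head? with _ | e
    · rw [hvh, Option.none_or] at hy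
      have : c' = y := by simpa using hy
      rw [← this]
      exact hnil (List.head?_eq_none_iff.1 hvh)
    · rw [hvh, Option.some_or] at hy
      have : e = y := by simpa using hy
      rw [← this]
      exact fun h => hhead e hvh h.symm
  -- the last letter of `v ++ [c'] ++ v.reverse` is the first letter of `v`, or `c'`; it is not `c`
  have hjoin : ∀ x ∈ (v ++ [c'] ++ v.reverse).getLast?, x ≠ c := by
    intro x hx
    rw [List.getLast?_append, List.getLast?_reverse, List.getLast?_concat] at hx
    rcases hvh : v.head? with _ | e
    · rw [hvh, Option.none_or] at hx
      have : c' = x := by simpa using hx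
      rw [← this]
      exact (hnil (List.head?_eq_none_iff.1 hvh)).symm
    · rw [hvh, Option.some_or] at hx
      have : e = x := by simpa using hx
      rw [← this]
      exact hhead e hvh
  have h1 : List.IsChain (· ≠ ·) (v ++ [c']) :=
    hv.append (List.isChain_singleton _) fun x hx y hy => by
      have : c' = y := by simpa using hy
      rw [← this]
      exact hlast x hx
  have h2 : List.IsChain (· ≠ ·) (v ++ [c'] ++ v.reverse) :=
    h1.append hrev fun x hx y hy => by
      rw [List.getLast?_concat] at hx
      have : c' = x := by simpa using hx
      rw [← this]
      rw [List.head?_reverse] at hy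
      exact fun h => hlast y hy h.symm
  have h3 : List.IsChain (· ≠ ·) (v ++ [c'] ++ v.reverse ++ [c]) :=
    h2.append (List.isChain_singleton _) fun x hx y hy => by
      have : c = y := by simpa using hy
      rw [← this]
      exact hjoin x hx
  refine h3.append h3 fun x hx y hy => ?_
  rw [List.getLast?_concat] at hx
  have : c = x := by simpa using hx
  rw [← this]
  rw [List.append_assoc (v ++ [c']) v.reverse [c]] at hy
  exact hfirst _ y hy

/-- Both ends `a`, `a · c` of the initial rung of a reflection structure are fixed by the doubled word.
[folklore] -/
theorem reflection_fixed (μ : Fin 3 → Perm (Fin n)) (hμ : ∀ c, μ c * μ c = 1) (c c' : Fin 3)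
    (a : Fin n) (v : List (Fin 3))
    (hinc : μ c' (v.foldl (fun v c => μ c v) a) = v.foldl (fun v c => μ c v) (μ c a)) :
    (v ++ [c'] ++ v.reverse ++ [c]).foldl (fun v c => μ c v) a = a ∧
      (v ++ [c'] ++ v.reverse ++ [c]).foldl (fun v c => μ c v) (μ c a) = μ c a := by
  have hcc : ∀ x, μ c (μ c x) = x := fun x => by
    have : (μ c * μ c) x = x := by rw [hμ c]; rfl
    simpa using this
  have hinc' : μ c' (v.foldl (fun v c => μ c v) (μ c a)) = v.foldl (fun v c => μ c v) a := by
    rw [← hinc]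
    have : (μ c' * μ c') (v.foldl (fun v c => μ c v) a) = v.foldl (fun v c => μ c v) a := by
      rw [hμ c']; rfl
    simpa using this
  constructor
  · rw [act_append, act_append, act_append]
    simp only [List.foldl_cons, List.foldl_nil]
    rw [hinc, act_reverse μ hμ, hcc]
  · rw [act_append, act_append, act_append]
    simp only [List.foldl_cons, List.foldl_nil]
    rw [hinc', act_reverse μ hμ]

/-- Trajectories of the twin pair `(z; a, a·c)` of a reflection structure: for `t < 2|v| + 2` the `t`-th
trajectory points of `a` and `a·c` are the two ends of a structure rung `r_i` (`i ≤ |v|`), on the same sides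
for `t ≤ |v|` (`i = t`) and on swapped sides for `t = |v| + 1 + j` (`i = |v| - j`). [folklore] -/
theorem reflection_traj (μ : Fin 3 → Perm (Fin n)) (hμ : ∀ c, μ c * μ c = 1) (c c' : Fin 3)
    (a : Fin n) (v : List (Fin 3))
    (hinc : μ c' (v.foldl (fun v c => μ c v) a) = v.foldl (fun v c => μ c v) (μ c a))
    (t : ℕ) (ht : t < 2 * v.length + 2) :
    ∃ i ≤ v.length,
      (((v ++ [c'] ++ v.reverse ++ [c]).take t).foldl (fun v c => μ c v) a =
          (v.take i).foldl (fun v c => μ c v) a ∧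
        ((v ++ [c'] ++ v.reverse ++ [c]).take t).foldl (fun v c => μ c v) (μ c a) =
          (v.take i).foldl (fun v c => μ c v) (μ c a)) ∨
      (((v ++ [c'] ++ v.reverse ++ [c]).take t).foldl (fun v c => μ c v) a =
          (v.take i).foldl (fun v c => μ c v) (μ c a) ∧
        ((v ++ [c'] ++ v.reverse ++ [c]).take t).foldl (fun v c => μ c v) (μ c a) =
          (v.take i).foldl (fun v c => μ c v) a) := by
  have hinc' : μ c' (v.foldl (fun v c => μ c v) (μ c a)) = v.foldl (fun v c => μ c v) a := by
    rw [← hinc]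
    have : (μ c' * μ c') (v.foldl (fun v c => μ c v) a) = v.foldl (fun v c => μ c v) a := by
      rw [hμ c']; rfl
    simpa using this
  rcases le_or_gt t v.length with htm | htm
  · -- on the way out: `z.take t = v.take t`
    refine ⟨t, htm, Or.inl ?_⟩
    have hz : (v ++ [c'] ++ v.reverse ++ [c]).take t = v.take t := by
      rw [List.take_append_of_le_length (by simp; omega),
        List.take_append_of_le_length (by simp; omega), List.take_append_of_le_length htm]
    rw [hz]
    exact ⟨rfl, rfl⟩
  · -- on the way back: `z.take (|v| + 1 + j) = v ++ [c'] ++ v.reverse.take j`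
    obtain ⟨j, hj, rfl⟩ : ∃ j ≤ v.length, t = v.length + 1 + j :=
      ⟨t - (v.length + 1), by omega, by omega⟩
    refine ⟨v.length - j, Nat.sub_le _ _, Or.inr ?_⟩
    have hz : (v ++ [c'] ++ v.reverse ++ [c]).take (v.length + 1 + j) =
        (v ++ [c']) ++ v.reverse.take j := by
      rw [List.take_append_of_le_length (by simp; omega)]
      conv_lhs => rw [← List.take_append_drop j v.reverse, ← List.append_assoc]
      rw [List.take_append_of_le_length (by simp; omega), List.take_of_length_le (by simp; omega)]
    rw [hz, act_append, act_append, act_append, act_append]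
    simp only [List.foldl_cons, List.foldl_nil]
    rw [hinc, hinc', act_reverse_take μ hμ, act_reverse_take μ hμ]
    exact ⟨rfl, rfl⟩

end CleanReflection

open CleanReflection in
/-- **A clean reflection structure is a clean closed rung walk** (crux `SnSubsetDichotomy.HyperoctahedralThreshold`,
stmt-MatrixMultiplication-10883, reflection route of the open core `stub_poorRigidCore`).  For involutions
`μ c` of `Fin n`, a point `a` moved by `μ c`, colours `c, c'` and a reduced word `v` not starting with `c`
and not ending with `c'` (`c ≠ c'` if `v = []`) with `(a · v) · c' = (a · c) · v`: if the rungs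
`r_t = {a · v.take t, (a·c) · v.take t}` (`t ≤ |v|`) are pairwise equal-or-disjoint and avoid `R`, then
there is closed-rung-walk data `(k, p, q, col)` in the format of the conclusion of `stub_poorRigidCore`
(distinct rung ends, steps as sets, cyclically distinct consecutive colours, pairwise equal-or-disjoint rungs,
all points outside `R`) with `k + 1 = 2|v| + 2` — namely the twin-pair walk of `(v ++ [c'] ++ v.reverse ++ [c]; a, a·c)`.
[folklore] -/
theorem cleanReflection_walk (n : ℕ) (μ : Fin 3 → Equiv.Perm (Fin n)) (hμ : ∀ c, μ c * μ c = 1)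
    (R : Finset (Fin n)) (c c' : Fin 3) (a : Fin n) (v : List (Fin 3)) (hca : μ c a ≠ a)
    (hv : List.IsChain (· ≠ ·) v) (hhead : ∀ e ∈ v.head?, e ≠ c) (hlast : ∀ e ∈ v.getLast?, e ≠ c')
    (hnil : v = [] → c ≠ c')
    (hinc : μ c' (v.foldl (fun v c => μ c v) a) = v.foldl (fun v c => μ c v) (μ c a))
    (hclean : ∀ s ≤ v.length, ∀ t ≤ v.length,
      ((v.take s).foldl (fun v c => μ c v) a = (v.take t).foldl (fun v c => μ c v) a ∧
          (v.take s).foldl (fun v c => μ c v) (μ c a) = (v.take t).foldl (fun v c => μ c v) (μ c a)) ∨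
        ((v.take s).foldl (fun v c => μ c v) a = (v.take t).foldl (fun v c => μ c v) (μ c a) ∧
          (v.take s).foldl (fun v c => μ c v) (μ c a) = (v.take t).foldl (fun v c => μ c v) a) ∨
        ((v.take s).foldl (fun v c => μ c v) a ≠ (v.take t).foldl (fun v c => μ c v) a ∧
          (v.take s).foldl (fun v c => μ c v) a ≠ (v.take t).foldl (fun v c => μ c v) (μ c a) ∧
          (v.take s).foldl (fun v c => μ c v) (μ c a) ≠ (v.take t).foldl (fun v c => μ c v) a ∧
          (v.take s).foldl (fun v c => μ c v) (μ c a) ≠ (v.take t).foldl (fun v c => μ c v) (μ c a)))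
    (hR : ∀ t ≤ v.length,
      (v.take t).foldl (fun v c => μ c v) a ∉ R ∧ (v.take t).foldl (fun v c => μ c v) (μ c a) ∉ R) :
    ∃ (k : ℕ) (p q : Fin (k + 1) → Fin n) (col : Fin (k + 1) → Fin 3), (∀ i, p i ≠ q i) ∧
      (∀ i, (μ (col i) (p i) = p (i + 1) ∧ μ (col i) (q i) = q (i + 1)) ∨
        (μ (col i) (p i) = q (i + 1) ∧ μ (col i) (q i) = p (i + 1))) ∧
      (∀ i, col i ≠ col (i + 1)) ∧
      (∀ i j, (p i = p j ∧ q i = q j) ∨ (p i = q j ∧ q i = p j) ∨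
        (p i ≠ p j ∧ p i ≠ q j ∧ q i ≠ p j ∧ q i ≠ q j)) ∧
      (∀ i, p i ∉ R ∧ q i ∉ R) ∧ k + 1 = 2 * v.length + 2 := by
  set z : List (Fin 3) := v ++ [c'] ++ v.reverse ++ [c] with hzdef
  have hzlen : z.length = 2 * v.length + 2 := by
    simp [hzdef, List.length_append]; ring
  obtain ⟨hfa, hfca⟩ := reflection_fixed μ hμ c c' a v hinc
  -- distinct ends of the structure rungs
  have hpq : ∀ i, (v.take i).foldl (fun v c => μ c v) a ≠ (v.take i).foldl (fun v c => μ c v) (μ c a) :=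
    fun i h => hca (GoodTwin.foldl_injective μ (v.take i) h).symm
  -- mirror-compatible coincidences of the twin pair, from cleanness of the structure
  have key : ∀ s < z.length, ∀ t < z.length,
      ((z.take s).foldl (fun v c => μ c v) a = (z.take t).foldl (fun v c => μ c v) a ↔
        (z.take s).foldl (fun v c => μ c v) (μ c a) = (z.take t).foldl (fun v c => μ c v) (μ c a)) ∧
      ((z.take s).foldl (fun v c => μ c v) a = (z.take t).foldl (fun v c => μ c v) (μ c a) ↔
        (z.take s).foldl (fun v c => μ c v) (μ c a) = (z.take t).foldl (fun v c => μ c v) a) := by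
    intro s hs t ht
    obtain ⟨i, hi, hs'⟩ := reflection_traj μ hμ c c' a v hinc s (hzlen ▸ hs)
    obtain ⟨j, hj, ht'⟩ := reflection_traj μ hμ c c' a v hinc t (hzlen ▸ ht)
    obtain ⟨h1, h2⟩ := eod_iff (hpq j) (hclean i hi j hj)
    rcases hs' with ⟨hs1, hs2⟩ | ⟨hs1, hs2⟩ <;> rcases ht' with ⟨ht1, ht2⟩ | ⟨ht1, ht2⟩ <;>
      rw [hs1, hs2, ht1, ht2]
    · exact ⟨h1, h2⟩
    · exact ⟨h2, h1⟩
    · exact ⟨h2.symm, h1.symm⟩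
    · exact ⟨h1.symm, h2.symm⟩
  have hRz : ∀ t < z.length,
      (z.take t).foldl (fun v c => μ c v) a ∉ R ∧ (z.take t).foldl (fun v c => μ c v) (μ c a) ∉ R := by
    intro t ht
    obtain ⟨i, hi, h | h⟩ := reflection_traj μ hμ c c' a v hinc t (hzlen ▸ ht)
    · rw [h.1, h.2]; exact hR i hi
    · rw [h.1, h.2]; exact ⟨(hR i hi).2, (hR i hi).1⟩
  obtain ⟨k, p, q, col, h1, h2, h3, h4, h5, hk⟩ :=
    twoPoint_walk μ R z a (μ c a) (by omega) (reflection_isChain c c' v hv hhead hlast hnil)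
      (fun h => hca h.symm) hfa hfca key hRz
  exact ⟨k, p, q, col, h1, h2, h3, h4, h5, hk.trans hzlen⟩

/-- **Reflection-route form of the conclusion of the open core** (`stub_poorRigidCore` /`stub_cleanWalk` of
line `refutation-local-symmetry`, crux stmt-MatrixMultiplication-10883): a clean reflection structure
`(a; c, v, c')` for fixed-point-free involutions, with all points outside `R` and `2|v| + 2 ≤ n^{1/4}`, gives
the conclusion verbatim — a closed rung walk `(k, p, q, col)` with distinct rung ends, steps as sets,
cyclically distinct consecutive colours, pairwise equal-or-disjoint rungs, all points outside `R`, and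
`k + 1 ≤ n^{1/4}`. [folklore] -/
theorem cleanReflection_core (n : ℕ) (μ : Fin 3 → Equiv.Perm (Fin n))
    (hμ : ∀ i, μ i * μ i = 1 ∧ ∀ v, μ i v ≠ v)
    (R : Finset (Fin n)) (c c' : Fin 3) (a : Fin n) (v : List (Fin 3))
    (hv : List.IsChain (· ≠ ·) v) (hhead : ∀ e ∈ v.head?, e ≠ c) (hlast : ∀ e ∈ v.getLast?, e ≠ c')
    (hnil : v = [] → c ≠ c')
    (hinc : μ c' (v.foldl (fun v c => μ c v) a) = v.foldl (fun v c => μ c v) (μ c a))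
    (hclean : ∀ s ≤ v.length, ∀ t ≤ v.length,
      ((v.take s).foldl (fun v c => μ c v) a = (v.take t).foldl (fun v c => μ c v) a ∧
          (v.take s).foldl (fun v c => μ c v) (μ c a) = (v.take t).foldl (fun v c => μ c v) (μ c a)) ∨
        ((v.take s).foldl (fun v c => μ c v) a = (v.take t).foldl (fun v c => μ c v) (μ c a) ∧
          (v.take s).foldl (fun v c => μ c v) (μ c a) = (v.take t).foldl (fun v c => μ c v) a) ∨
        ((v.take s).foldl (fun v c => μ c v) a ≠ (v.take t).foldl (fun v c => μ c v) a ∧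
          (v.take s).foldl (fun v c => μ c v) a ≠ (v.take t).foldl (fun v c => μ c v) (μ c a) ∧
          (v.take s).foldl (fun v c => μ c v) (μ c a) ≠ (v.take t).foldl (fun v c => μ c v) a ∧
          (v.take s).foldl (fun v c => μ c v) (μ c a) ≠ (v.take t).foldl (fun v c => μ c v) (μ c a)))
    (hR : ∀ t ≤ v.length,
      (v.take t).foldl (fun v c => μ c v) a ∉ R ∧ (v.take t).foldl (fun v c => μ c v) (μ c a) ∉ R)
    (hshort : (2 * (v.length : ℝ) + 2) ≤ (n : ℝ) ^ ((1 : ℝ) / 4)) :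
    ∃ (k : ℕ) (p q : Fin (k + 1) → Fin n) (col : Fin (k + 1) → Fin 3), (∀ i, p i ≠ q i) ∧
      (∀ i, (μ (col i) (p i) = p (i + 1) ∧ μ (col i) (q i) = q (i + 1)) ∨
        (μ (col i) (p i) = q (i + 1) ∧ μ (col i) (q i) = p (i + 1))) ∧
      (∀ i, col i ≠ col (i + 1)) ∧
      (∀ i j, (p i = p j ∧ q i = q j) ∨ (p i = q j ∧ q i = p j) ∨
        (p i ≠ p j ∧ p i ≠ q j ∧ q i ≠ p j ∧ q i ≠ q j)) ∧
      (∀ i, p i ∉ R ∧ q i ∉ R) ∧ ((k : ℝ) + 1) ≤ (n : ℝ) ^ ((1 : ℝ) / 4) := by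
  obtain ⟨k, p, q, col, h1, h2, h3, h4, h5, hk⟩ :=
    cleanReflection_walk n μ (fun i => (hμ i).1) R c c' a v ((hμ c).2 a) hv hhead hlast hnil hinc hclean hR
  refine ⟨k, p, q, col, h1, h2, h3, h4, h5, ?_⟩
  have : ((k : ℝ) + 1) = 2 * (v.length : ℝ) + 2 := by exact_mod_cast hk
  rw [this]; exact hshort

/-- **Registered form** (`stub_cleanReflection`, a `--supports` sub-goal of crux stmt-MatrixMultiplication-10883):
`cleanReflection_core` fully quantified, the word called `g` as in the line's `stub_sameColourSupply`
(whose same-colour structures `(a, g)` are the case `c' = c`). [folklore] -/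
theorem stub_cleanReflection : ∀ (n : ℕ) (μ : Fin 3 → Equiv.Perm (Fin n)), (∀ i, μ i * μ i = 1 ∧ ∀ v, μ i v ≠ v) → ∀ (R : Finset (Fin n)) (c c' : Fin 3) (a : Fin n) (g : List (Fin 3)), List.IsChain (· ≠ ·) g → (∀ e ∈ g.head?, e ≠ c) → (∀ e ∈ g.getLast?, e ≠ c') → (g = [] → c ≠ c') → μ c' (g.foldl (fun v b => μ b v) a) = g.foldl (fun v b => μ b v) (μ c a) → (∀ s ≤ g.length, ∀ t ≤ g.length, ((g.take s).foldl (fun v b => μ b v) a = (g.take t).foldl (fun v b => μ b v) a ∧ (g.take s).foldl (fun v b => μ b v) (μ c a) = (g.take t).foldl (fun v b => μ b v) (μ c a)) ∨ ((g.take s).foldl (fun v b => μ b v) a = (g.take t).foldl (fun v b => μ b v) (μ c a) ∧ (g.take s).foldl (fun v b => μ b v) (μ c a) = (g.take t).foldl (fun v b => μ b v) a) ∨ ((g.take s).foldl (fun v b => μ b v) a ≠ (g.take t).foldl (fun v b => μ b v) a ∧ (g.take s).foldl (fun v b => μ b v) a ≠ (g.take t).foldl (fun v b => μ b v) (μ c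 a) ∧ (g.take s).foldl (fun v b => μ b v) (μ c a) ≠ (g.take t).foldl (fun v b => μ b v) a ∧ (g.take s).foldl (fun v b => μ b v) (μ c a) ≠ (g.take t).foldl (fun v b => μ b v) (μ c a))) → (∀ t ≤ g.length, (g.take t).foldl (fun v b => μ b v) a ∉ R ∧ (g.take t).foldl (fun v b => μ b v) (μ c a) ∉ R) → (2 * (g.length : ℝ) + 2) ≤ (n : ℝ) ^ ((1 : ℝ) / 4) → ∃ (k : ℕ) (p q : Fin (k + 1) → Fin n) (col : Fin (k + 1) → Fin 3), (∀ i, p i ≠ q i) ∧ (∀ i, (μ (col i) (p i) = p (i + 1) ∧ μ (col i) (q i) = q (i + 1)) ∨ (μ (col i) (p i) = q (i + 1) ∧ μ (col i) (q i) = p (i + 1))) ∧ (∀ i, col i ≠ col (i + 1)) ∧ (∀ i j, (p i = p j ∧ q i = q j) ∨ (p i = q j ∧ q i = p j) ∨ (p i ≠ p j ∧ p i ≠ q j ∧ q i ≠ p j ∧ q i ≠ q j)) ∧ (∀ i, p i ∉ R ∧ q i ∉ R) ∧ ((k : ℝ) + 1) ≤ (n : ℝ) ^ ((1 : ℝ)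 / 4) :=
  fun n μ hμ R c c' a g hg hh hl hn hinc hcl hR hs =>
    cleanReflection_core n μ hμ R c c' a g hg hh hl hn hinc hcl hR hs

end Summit.MatrixMultiplication.MatrixMultiplication.Theorems.HyperoctahedralThreshold
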